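import Literature.NumberTheory.Automorphic.UnitaryThreeKHFactorization          -- ★ p841018 (B-p04): `mem_centralizer_of_coe_eq_block`, block relations; imports ★ (F1)
import HarnessLib

/-!
# The torus `T_H^θ = Z_H(t_θ)` inside `H = Z_{U(Φ₃)}(diag(1,−1,1)) ≅ U(1,1) × U(1)`: commuting with a block element `!![A,0,B;0,b,0;C,0,A]`
(Flicker (1998), *Elementary proof of the fundamental lemma for a unitary group*, Prop. 6 p. 83: the torus `T_H^θ = D₁⁻¹ T₂^θ D₁ × E¹`,
`T₂^θ = {ε (u, vθD; v∕θ, u)}`)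

Topic `NumberTheory/Automorphic`; namespace `Literature.NumberTheory.Automorphic.UnitaryGroup`.  KERNEL mathematics only: theorems, no definition, no
named fact, no instance, no notation, no `sorry`.  Cell `pub/hodgecm-mathlib`, programme P3a, road «D-N7-inert», MAP v3 «N7-ns COUNT FROM FLICKER», brick
(F3c-γ) «LATTICE ↔ COSET TRANSPORT» FILE γ2a (LEAD F0P3a-plan (g9) T8-60 (C); architect A-p06 (g26); consumer B-p04 (g33) ★ p840967 at `T := Z_H(t_θ)`).
HC_CM is proved only modulo the printed citations (2 remaining named inputs hLiu418, h413) until rung 0 closes; this file discharges no named fact.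

MATHEMATICS.  In `U = U(σ, Φ₃)(K)`, elements of `H` have the block shape `h = !![α,0,β;0,e,0;γ,0,δ]` (★ `exists_coe_eq_block_of_mem_centralizer`).  For a block
element `t = !![A,0,B;0,b,0;C,0,A]` with EQUAL diagonal corner entries (F0P3-p02's torus elements `t_θ` of ★ `UnitFundamentalLemmaInertFlickerTorus` have
`A = e(a₀+c₀)`, `B = −e(a₀−c₀)θ`, `C = −e(a₀−c₀)θ′`) and `C ≠ 0` (regularity `a₀ ≠ c₀`):
**`h t = t h ↔ α = δ ∧ β·C = B·γ`** — the corner of `h` lies in `A·1 + K·(0 B; C 0)`, Flicker's `(u, vθD; v∕θ, u)`-shape; in particular `Z_H(t)` does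
not depend on `A`, `b` and is the same for all regular `t` of the torus `T^θ` (`B∕C = θ²`).

References: [Flicker1998UnitaryFL] Y. Z. Flicker, Canad. J. Math. 50 (1998), Prop. 6 p. 83 · [Rogawski1990] J. D. Rogawski, Ann. of Math. Stud. 123, §4.9 p. 55. -/

set_option autoImplicit false

open Matrix
open scoped MatrixGroups

namespace Literature.NumberTheory.Automorphic.UnitaryGroup

variable {K : Type*} [Field K] (σ : K →+* K) {J : Matrix (Fin 3) (Fin 3) K}

/-- The product of two block elements: `!![α,0,β;0,e,0;γ,0,δ] * !![A,0,B;0,b,0;C,0,D] = !![αA+βC, 0, αB+βD; 0, eb, 0; γA+δC, 0, γB+δD]`.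
[cite: Flicker1998UnitaryFL, Prop. 6 p. 83] -/
theorem block_mul_block (α β γ δ e A B C D b : K) :
    !![α, 0, β; 0, e, 0; γ, 0, δ] * !![A, 0, B; 0, b, 0; C, 0, D] =
      !![α * A + β * C, 0, α * B + β * D; 0, e * b, 0; γ * A + δ * C, 0, γ * B + δ * D] := by
  ext i j
  fin_cases i <;> fin_cases j <;> simp [Matrix.mul_apply, Fin.sum_univ_three]

/-- **COMMUTING WITH A REGULAR TORUS BLOCK**: for block elements `h = !![α,0,β;0,e,0;γ,0,δ]`, `t = !![A,0,B;0,b,0;C,0,A]` of `U` with `C ≠ 0`: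
`h * t = t * h ↔ α = δ ∧ β * C = B * γ`. [cite: Flicker1998UnitaryFL, Prop. 6 p. 83] -/
theorem block_mul_eq_mul_iff {h t : ↥(unitaryGroupOfForm σ J)} {α β γ δ e A B C b : K}
    (hh : ((h : GL (Fin 3) K) : Matrix (Fin 3) (Fin 3) K) = !![α, 0, β; 0, e, 0; γ, 0, δ])
    (ht : ((t : GL (Fin 3) K) : Matrix (Fin 3) (Fin 3) K) = !![A, 0, B; 0, b, 0; C, 0, A]) (hC : C ≠ 0) :
    h * t = t * h ↔ α = δ ∧ β * C = B * γ := by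
  have key : h * t = t * h ↔ ((h : GL (Fin 3) K) : Matrix (Fin 3) (Fin 3) K) * ((t : GL (Fin 3) K) : Matrix (Fin 3) (Fin 3) K) =
      ((t : GL (Fin 3) K) : Matrix (Fin 3) (Fin 3) K) * ((h : GL (Fin 3) K) : Matrix (Fin 3) (Fin 3) K) := by
    rw [← Units.val_mul, ← Units.val_mul, ← Subgroup.coe_mul, ← Subgroup.coe_mul]
    exact ⟨fun h1 => by rw [h1], fun h1 => Subtype.ext (Units.ext h1)⟩
  rw [key, hh, ht, block_mul_block, block_mul_block]
  constructor
  · intro hM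
    have h00 : α * A + β * C = A * α + B * γ := by
      have := congrArg (fun M : Matrix (Fin 3) (Fin 3) K => M 0 0) hM; simpa using this
    have h02 : α * B + β * A = A * β + B * δ := by
      have := congrArg (fun M : Matrix (Fin 3) (Fin 3) K => M 0 2) hM; simpa using this
    have h20 : γ * A + δ * C = C * α + A * γ := by
      have := congrArg (fun M : Matrix (Fin 3) (Fin 3) K => M 2 0) hM; simpa using this
    have e1 : β * C = B * γ := by linear_combination h00
    have e3 : C * (δ - α) = 0 := by linear_combination h20
    exact ⟨(sub_eq_zero.1 ((mul_eq_zero.1 e3).resolve_left hC)).symm, e1⟩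
  · rintro ⟨rfl, hβγ⟩
    ext i j
    fin_cases i <;> fin_cases j <;> simp <;> first | ring1 | linear_combination hβγ | linear_combination -hβγ

/-- **`Z_H(t)` FOR A REGULAR TORUS BLOCK, membership form**: with `t = !![A,0,B;0,b,0;C,0,A] ∈ H` (`C ≠ 0`), an element `h ∈ H` with block
`!![α,0,β;0,e,0;γ,0,δ]` centralises `t` iff `α = δ ∧ β·C = B·γ`; so `T_H^θ := Z_H(t_θ)` is cut out of `H` by two linear conditions on the corner and does not
depend on `A`, `b` (all regular elements of the torus have the same centraliser). [cite: Flicker1998UnitaryFL, Prop. 6 p. 83] -/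
theorem mem_centralizer_block_iff {h t : ↥(unitaryGroupOfForm σ J)} {α β γ δ e A B C b : K}
    (hh : ((h : GL (Fin 3) K) : Matrix (Fin 3) (Fin 3) K) = !![α, 0, β; 0, e, 0; γ, 0, δ])
    (ht : ((t : GL (Fin 3) K) : Matrix (Fin 3) (Fin 3) K) = !![A, 0, B; 0, b, 0; C, 0, A]) (hC : C ≠ 0) :
    h ∈ Subgroup.centralizer ({t} : Set ↥(unitaryGroupOfForm σ J)) ↔ α = δ ∧ β * C = B * γ := by
  rw [Subgroup.mem_centralizer_singleton_iff]
  exact block_mul_eq_mul_iff σ hh ht hC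

end Literature.NumberTheory.Automorphic.UnitaryGroup
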